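import Summits.BirchSwinnertonDyer.BirchSwinnertonDyer.Theorems.Rank1ResidualJetWeilTransportConj
import Summits.BirchSwinnertonDyer.Rank1Residual.X11b.WeilTransport
import Literature.NumberTheory.GaloisCohomology.KolyvaginSystems
import Literature.NumberTheory.EllipticCurves.ArchimedeanKummerImageMaximal
import HarnessLib

/-!
# T1 JET (cell `bsd-jet`), road K, stub S1 → row form: the WEIL TRANSPORT `H¹(K, E[N]) ≅ H¹(K, E[N]^D)`
# on Selmer groups, eigenclasses and local images (bridge SD1 of sheet `PV1-ROADK-S1.md` §v2–v3)

HONEST FRAMING (programme file `BSD-LIT2PART-PROGRAMME-v1.md` §HONESTY, verbatim): «no tranche here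
proves BSD; ARM L moves the LITERAL column of an r ≤ 1 census into the kernel-proved-modulo-named-print
column; ARM P changes what «named print» is worth.» THEOREMS ONLY (seat `bsd-jet-pv-1`, session g5;
`--supports stmt-BirchSwinnertonDyer-14418`, helper): no definition, no named fact, no `sorry`.
Nothing is booked; 0 classes move.

## What

The signed Poitou–Tate identities of the cell (`Rank1ResidualJetSignedGlobalDuality*`,
`…SignedDualityRelaxed`, `…SignedDualityPair`) have their dual side in `H¹(K, E[N]^D)`; the row
theorem `JET.tamagawaExponent_le_mInfty_of_rowData` wants the dual Selmer module `C'` INSIDE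
`H¹(K, E[N])` (its Čebotarev step localises `C'` with the `E[N]`-localisation). For a Weil pairing
datum `e` on `E[N]` (bilinear, `μ_N`-valued, `Γ_K`-equivariant, non-degenerate) with Weil transport
`w = H¹(weilDualIntertwining e) : H¹(K, E[N]) → H¹(K, E[N]^D)` this file proves:

* `map_weilDual_bijective` — `w` is bijective (X11b `map_weilDual_map_weilDualInv` both ways);
* `comap_map_weilDual_selmerGroup` — `w⁻¹(H¹_{𝓕^*}) = H¹_{𝓕^∨}`, `𝓕^∨ = inv.dualTransported 𝓕 w` the
  dual structure transported to `E[N]` (Sakamoto's (H.SD) reading), for ANY structure `𝓕`; hence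
  `w⁻¹(H¹_{𝓕^*}) = H¹_𝓕` for a SELF-DUAL `𝓕` (`𝓕^∨ = 𝓕`);
* `comap_map_weilDual_ker_conjActDual` — `w⁻¹((H^D)^s) = H^s` for the `s`-eigenspaces of `σ` (needs
  the `τ`-equivariance `hτe` of the datum under the lift `liftAut σ`, `map_weilDual_conjAct`);
* `relIndex_comap_map_weilDual` — `[w⁻¹A : w⁻¹B] = [A : B]`;
* `natCard_map_localization_map_weilDual` — `#loc'_v(w C) = #loc_v(C)` (`loc'_v ∘ w = w_v ∘ loc_v`,
  `w_v` injective);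
* `dualTransported_inl_eq_of_odd` — at an infinite place every local condition is self-dual for odd
  `N` (`H¹(K_w, E[N]) = 0`).

References (locators only; no cited FACT is declared): [cite: MilneADT2006, Ch. I §6, proof of
Prop. 6.9 («the cup product induced by the e_m-pairing»)] [cite: Jetchev2008, §5 Thm. 5.1 (self-dual
𝓕)] [cite: Sakamoto2024, §3.1.2 (H.SD)]. Design: no definitions; universe `u` for `K`. Axioms:
`propext`, `Classical.choice`, `Quot.sound`.
-/

set_option autoImplicit false

noncomputable section

open scoped Classical
open Function NumberField IsDedekindDomain WeierstrassCurve Field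
open Literature.NumberTheory.EllipticCurves Literature.NumberTheory.GaloisRepresentations
open Literature.NumberTheory.GaloisCohomology
open Literature.NumberTheory.GaloisRepresentations.DiscreteGaloisModule (localTatePairingZMod
  tateDual SelmerStructure)
open Summit.BirchSwinnertonDyer.Rank1Residual.X11b.LocBridge

universe u

namespace Summit.BirchSwinnertonDyer.Rank1Residual.JET.GlobalDuality

section WeilTransport

variable {K : Type u} [Field K] [NumberField K] (W : WeierstrassCurve ℚ) (N : ℕ) [NeZero N]
  [(W.baseChange K).IsElliptic]
  (e : geomTorsion (W.baseChange K) N → geomTorsion (W.baseChange K) N → AlgebraicClosure K)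
  (hμ : ∀ S T, e S T ^ N = 1)
  (hadd₁ : ∀ S₁ S₂ T, e (S₁ + S₂) T = e S₁ T * e S₂ T)
  (hadd₂ : ∀ S T₁ T₂, e S (T₁ + T₂) = e S T₁ * e S T₂)
  (hgal : ∀ (g : absoluteGaloisGroup K) (S T : geomTorsion (W.baseChange K) N),
    g • e S T = e (g • S) (g • T))
  (hnondeg : ∀ T, (∀ S, e S T = 1) → T = 0)

include hnondeg in
/-- **The Weil transport `w = H¹(K, weilDualIntertwining e)` is bijective on `H¹(K, ·)`** (both round
trips with X11b's inverse transport `weilDualInv`). [cite: MilneADT2006, Ch. I §6, proof of Prop. 6.9] -/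
theorem map_weilDual_bijective :
    Bijective (galoisCohomology.map
      (weilDualIntertwining (W.baseChange K) N e hμ hadd₁ hadd₂ hgal) 1) :=
  ⟨LeftInverse.injective (g := galoisCohomology.map (weilDualInv (W.baseChange K) N e hμ hadd₁ hadd₂
      hgal hnondeg) 1) (map_weilDualInv_map_weilDual (W.baseChange K) N e hμ hadd₁ hadd₂ hgal hnondeg),
    RightInverse.surjective (g := galoisCohomology.map (weilDualInv (W.baseChange K) N e hμ hadd₁ hadd₂
      hgal hnondeg) 1) (map_weilDual_map_weilDualInv (W.baseChange K) N e hμ hadd₁ hadd₂ hgal hnondeg)⟩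

variable [Finite (geomTorsion (W.baseChange K) N)]

/-- **`w⁻¹(H¹_{𝓕^*}) = H¹_{𝓕^∨}`**: the preimage under the Weil transport of the dual Selmer group is
the Selmer group of the transported dual structure `𝓕^∨ = inv.dualTransported 𝓕 w` on `E[N]`
(localisation commutes with the change of coefficients). [cite: Sakamoto2024, §3.1.2 (H.SD)]
[cite: MilneADT2006, Ch. I §6, proof of Prop. 6.9] -/
theorem comap_map_weilDual_selmerGroup (inv : LocalInvariants K N)
    (𝓕 : SelmerStructure ((W.baseChange K).torsionGaloisModule N)) :
    ((inv.dualSelmerStructure ((W.baseChange K).torsionGaloisModule N) 𝓕).selmerGroup).comap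
        (galoisCohomology.map (weilDualIntertwining (W.baseChange K) N e hμ hadd₁ hadd₂ hgal) 1) =
      (inv.dualTransported 𝓕 (weilDualIntertwining (W.baseChange K) N e hμ hadd₁ hadd₂ hgal)).selmerGroup := by
  ext x
  rw [AddSubgroup.mem_comap, SelmerStructure.mem_selmerGroup_iff, SelmerStructure.mem_selmerGroup_iff]
  refine forall_congr' fun v => ?_
  rw [LocalInvariants.mem_dualTransported_iff]
  exact Iff.of_eq (congrArg (· ∈ _) (galoisCohomology.res_map_one (Place.Completion v) _ x))

/-- **Self-dual structures: `w⁻¹(H¹_{𝓕^*}) = H¹_𝓕`** when `𝓕^∨ = 𝓕` place by place (Jetchev: «the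
Selmer structure 𝓕 is self-dual, so 𝓕 = 𝓕^*»). [cite: Jetchev2008, §5 Thm. 5.1 and §3.3] -/
theorem comap_map_weilDual_selmerGroup_of_selfDual (inv : LocalInvariants K N)
    (𝓕 : SelmerStructure ((W.baseChange K).torsionGaloisModule N))
    (hsd : ∀ v, inv.dualTransported 𝓕 (weilDualIntertwining (W.baseChange K) N e hμ hadd₁ hadd₂ hgal) v = 𝓕 v) :
    ((inv.dualSelmerStructure ((W.baseChange K).torsionGaloisModule N) 𝓕).selmerGroup).comap
        (galoisCohomology.map (weilDualIntertwining (W.baseChange K) N e hμ hadd₁ hadd₂ hgal) 1) =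
      𝓕.selmerGroup := by
  rw [comap_map_weilDual_selmerGroup]
  have : inv.dualTransported 𝓕 (weilDualIntertwining (W.baseChange K) N e hμ hadd₁ hadd₂ hgal) = 𝓕 :=
    funext hsd
  rw [this]

include hnondeg in
/-- **`w x` is an `s`-eigenclass of `conjActDual` iff `x` is an `s`-eigenclass of `conjAct`**: the Weil
transport identifies the eigenspaces of `σ` on `H¹(K, E[N])` and on `H¹(K, E[N]^D)` — for a datum
equivariant under the lift `liftAut σ` (`map_weilDual_conjAct`) and non-degenerate (injectivity of
`w`). [cite: Jetchev2008, §5 Thm. 5.1] [cite: SilvermanAEC2009, Prop. III.8.1 (d)] -/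
theorem conjActDual_map_weilDual_eq_smul_iff (σ : K ≃ₐ[ℚ] K)
    (hτe : ∀ S T, liftAut σ (e S T) =
      e ((isLiftOfAut_liftAut σ).torsionMap W N S) ((isLiftOfAut_liftAut σ).torsionMap W N T))
    (s : ℤ) (x : galoisCohomology ((W.baseChange K).torsionGaloisModule N) 1) :
    conjActDual W σ N N (galoisCohomology.map
        (weilDualIntertwining (W.baseChange K) N e hμ hadd₁ hadd₂ hgal) 1 x) =
      s • galoisCohomology.map (weilDualIntertwining (W.baseChange K) N e hμ hadd₁ hadd₂ hgal) 1 x ↔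
      conjAct W σ N x = s • x := by
  rw [← map_weilDual_conjAct W σ N e hμ hadd₁ hadd₂ hgal hτe x,
    ← (galoisCohomology.map (weilDualIntertwining (W.baseChange K) N e hμ hadd₁ hadd₂ hgal) 1).map_zsmul]
  exact (map_weilDual_bijective W N e hμ hadd₁ hadd₂ hgal hnondeg).1.eq_iff

include hnondeg in
/-- **`[w⁻¹A : w⁻¹B] = [A : B]`** for subgroups of `H¹(K, E[N]^D)` (`w` surjective).
[cite: MilneADT2006, Ch. I §6, proof of Prop. 6.9] -/
theorem relIndex_comap_map_weilDual
    (A B : AddSubgroup (galoisCohomology (((W.baseChange K).torsionGaloisModule N).tateDual N) 1)) :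
    (A.comap (galoisCohomology.map (weilDualIntertwining (W.baseChange K) N e hμ hadd₁ hadd₂ hgal) 1)).relIndex
        (B.comap (galoisCohomology.map (weilDualIntertwining (W.baseChange K) N e hμ hadd₁ hadd₂ hgal) 1)) =
      A.relIndex B := by
  rw [AddSubgroup.relIndex_comap, AddSubgroup.map_comap_eq_self_of_surjective
    (map_weilDual_bijective W N e hμ hadd₁ hadd₂ hgal hnondeg).2]

include hnondeg in
/-- **`w(w⁻¹ A) = A`** (`w` surjective). [cite: MilneADT2006, Ch. I §6, proof of Prop. 6.9] -/
theorem map_comap_map_weilDual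
    (A : AddSubgroup (galoisCohomology (((W.baseChange K).torsionGaloisModule N).tateDual N) 1)) :
    (A.comap (galoisCohomology.map (weilDualIntertwining (W.baseChange K) N e hμ hadd₁ hadd₂ hgal) 1)).map
        (galoisCohomology.map (weilDualIntertwining (W.baseChange K) N e hμ hadd₁ hadd₂ hgal) 1) = A :=
  AddSubgroup.map_comap_eq_self_of_surjective (map_weilDual_bijective W N e hμ hadd₁ hadd₂ hgal hnondeg).2 A

include hnondeg in
/-- **`#loc'_v(w C) = #loc_v(C)`**: the local image of the Weil transport of `C ≤ H¹(K, E[N])` under the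
`E[N]^D`-localisation has the cardinality of the local image of `C` (`loc'_v ∘ w = w_v ∘ loc_v` and the
local transport `w_v` is injective). This converts `#loc'_λ(H¹_{𝓕^*} ∩ (H^D)^s)` of
`relIndex_mul_natCard_map_eq_of_relaxedAt` into the `#loc_λ(C')` of the row theorem's `hdual_ℓ`.
[cite: MilneADT2006, Ch. I §6, proof of Prop. 6.9] -/
theorem natCard_map_localization_map_weilDual (v : Place K)
    (C : AddSubgroup (galoisCohomology ((W.baseChange K).torsionGaloisModule N) 1)) :
    Nat.card ((C.map (galoisCohomology.map
        (weilDualIntertwining (W.baseChange K) N e hμ hadd₁ hadd₂ hgal) 1)).map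
        (galoisCohomology.localization (((W.baseChange K).torsionGaloisModule N).tateDual N) v 1)) =
      Nat.card (C.map (galoisCohomology.localization ((W.baseChange K).torsionGaloisModule N) v 1)) := by
  have h2 : (C.map (galoisCohomology.map
        (weilDualIntertwining (W.baseChange K) N e hμ hadd₁ hadd₂ hgal) 1)).map
        (galoisCohomology.localization (((W.baseChange K).torsionGaloisModule N).tateDual N) v 1) =
      (C.map (galoisCohomology.localization ((W.baseChange K).torsionGaloisModule N) v 1)).map
        (galoisCohomology.map ((weilDualIntertwining (W.baseChange K) N e hμ hadd₁ hadd₂ hgal).restrictField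
          (Place.Completion v)) 1) := by
    ext y
    simp only [AddSubgroup.mem_map]
    constructor
    · rintro ⟨z, ⟨x, hx, rfl⟩, rfl⟩
      exact ⟨_, ⟨x, hx, rfl⟩, (galoisCohomology.res_map_one (Place.Completion v) _ x).symm⟩
    · rintro ⟨z, ⟨x, hx, rfl⟩, rfl⟩
      exact ⟨_, ⟨x, hx, rfl⟩, galoisCohomology.res_map_one (Place.Completion v) _ x⟩
  rw [h2]
  exact AddSubgroup.card_map_of_injective
    (map_weilDual_restrictField_injective (W.baseChange K) N e hμ hadd₁ hadd₂ hgal hnondeg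
      (Place.Completion v))

end WeilTransport

/-! ### Self-duality at the infinite places (odd `N`) -/

section Infinite

variable {K : Type u} [Field K] [NumberField K] (W : WeierstrassCurve ℚ) (N : ℕ)

/-- **At an infinite place every local condition on `E[N]` is self-dual for odd `N`**:
`H¹(K_w, E[N]) = 0`, so any two subgroups coincide. [cite: MilneADT2006, I Rem. 3.7] -/
theorem addSubgroup_inl_eq_of_odd (hN : Odd N) (w : InfinitePlace K)
    (A B : AddSubgroup (galoisCohomology
      (((W.baseChange K).torsionGaloisModule N).toLocal (Sum.inl w : Place K)) 1)) : A = B := by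
  ext x
  have hx : x = 0 := galoisCohomology_one_torsion_eq_zero_infinitePlace_of_odd (W.baseChange K) w
    ((Int.odd_coe_nat N).mpr hN) x
  rw [hx]
  exact ⟨fun _ => zero_mem _, fun _ => zero_mem _⟩

end Infinite

end Summit.BirchSwinnertonDyer.Rank1Residual.JET.GlobalDuality

end
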